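import Mathlib.MeasureTheory.Integral.IntervalIntegral.FundThmCalculus
import Literature.Analysis.FunctionSpaces.TorusCalculusProofs
import Literature.Analysis.FunctionSpaces.TorusSpaceTime
import Literature.Analysis.FunctionSpaces.TorusSpaceTimeFields
import Literature.Analysis.FunctionSpaces.TorusTestFunction
import Literature.Analysis.FunctionSpaces.TorusFluidGlue
import Literature.Analysis.FunctionSpaces.TorusFluidGlueProofs
import HarnessLib

/-!
# The Euler–Reynolds system on the flat torus `T^d`

The *Euler–Reynolds system* is the relaxation of the incompressible Euler equations that drives
every convex-integration scheme for Euler since De Lellis–Székelyhidi (2013): a smooth triple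
`(v, p, R̊)` of a velocity field, a pressure and a symmetric trace-free `2`-tensor (the
*Reynolds stress*) on `T^d × S` solves

  `∂ₜ v + div (v ⊗ v) + ∇p = div R̊`,  `div v = 0`,

(Buckmaster–De Lellis–Székelyhidi–Vicol 2019, §2.1, the system (2.2) of the arXiv version with
the constraints `tr R̊ = 0` and `∫ p = 0` that follow it). When `R̊ = 0` this is the classical
Euler system; the main iterative proposition of a convex-integration scheme (BDSV 2019,
Prop. 2.1) produces a sequence of such triples with `R̊_q → 0` uniformly, whose velocities
converge to a weak solution of Euler.

## Contents

* `Torus.tensorDivergence S x = ∑ⱼ ∂ⱼ S^{(j)} (x)`: the (row-wise) divergence of a `2`-tensor field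
  `S : T^d → (d → ℝ^d)` stored by columns, `S x j = S(x) eⱼ ∈ ℝ^d`, so that
  `(div S)ᵢ = ∑ⱼ ∂ⱼ Sᵢⱼ`.
* `Torus.IsEulerReynoldsOn S v p R`: smooth (classical) solutions of the Euler–Reynolds system on
  `T^d × S`, `S ⊆ ℝ` a time set, with the one-sided time derivative `Torus.timeDerivWithin S`
  (the convention of `Torus.IsClassicalNSSolutionOn`), symmetric trace-free stress and mean-zero
  pressure.
* `Torus.IsEulerReynoldsOn.weak_identity` (proved): a classical Euler–Reynolds solution on
  `S ⊇ [0, T]` satisfies, for every smooth divergence-free test field `ψ` compactly supported in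
  `(0, T)`, the distributional identity
  `∫₀ᵀ ∫ (⟪v, ∂ₜψ⟫ + ⟪v, (v·∇)ψ⟫) dx dt = ∫₀ᵀ ∫ ∑ⱼ ⟪R^{(j)}, ∂ⱼψ⟫ dx dt`,
  i.e. `v` is a weak Euler solution up to the *Reynolds defect* on the right (which is
  `-∫∫ ⟨R̊, ∇ψ⟩`, bounded by `T · d · ‖R̊‖₀ ‖∇ψ‖₀`, `Torus.norm_integral_reynoldsDefect_le`). For
  `R = 0` this is `Torus.IsClassicalNSSolutionOn.isWeakNSSolutionOn_holds` with `ν = 0`.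
* `Torus.isEulerReynoldsOn_zero` (proved): the zero triple is a solution (the start of the BDSV
  iteration, §2.2: "`(v₀, R₀, p₀) = (0, 0, 0)`").
* `Torus.IsEulerReynoldsOn.timeRescale` (proved): the scaling symmetry
  `(v, p, R)(t, x) ↦ (c v, c² p, c² R)(c t, x)` from `[0, T]` to `[0, T/c]` (BDSV §2.2, the
  normalisation of the energy profile).
* `Torus.isWeakEulerSolutionOn_of_unifLimit` (proved): if `(v_q, p_q, R_q)` are classical
  Euler–Reynolds solutions on `[0, T] × T^d` with `v_q → u` uniformly and `‖R_q‖₀ → 0`, then `u`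
  is a weak Euler solution on `T^d × (0, T)` (`Torus.IsWeakEulerSolutionOn`; BDSV §2.2: "Since
  `R̊_q → 0` uniformly, the pair `(v, p)` solves the Euler equations").

## Design choices

* The stress is a map `R : ℝ → T^d → (d → EuclideanSpace ℝ d)` (columns), a genuine normed space
  over `ℝ` so that joint smoothness is `Torus.IsSmoothSpaceTimeOn S R`; the pointwise norm
  `‖R t x‖ = maxⱼ ‖R t x j‖₂` is the maximal Euclidean column norm (BDSV do not fix a matrix norm;
  all are equivalent up to dimensional constants). Symmetry `R t x i j = R t x j i` and
  `∑ᵢ R t x i i = 0` are fields of the structure.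
* The convective term is `Torus.convect (v t) (v t) = (v·∇)v`, which for the divergence-free
  smooth `v` of the structure equals `div (v ⊗ v)` pointwise (`∑ⱼ ∂ⱼ(vᵢ vⱼ) = ∑ⱼ vⱼ ∂ⱼ vᵢ`); this
  keeps the momentum equation literally that of `Torus.IsClassicalNSSolutionOn` plus `div R̊`.
* Generality: any finite index type `d` (BDSV: `d = Fin 3`).

## References

* T. Buckmaster, C. De Lellis, L. Székelyhidi Jr., V. Vicol, *Onsager's conjecture for admissible
  weak solutions*, Comm. Pure Appl. Math. 72 (2019) 229–274 = arXiv:1701.08678, §2.1 (the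
  Euler–Reynolds system and its constraints), §2.2 (start of the iteration from zero).
* C. De Lellis, L. Székelyhidi Jr., *Dissipative continuous Euler flows*, Invent. Math. 193
  (2013), §2 (Euler–Reynolds system, Def. 2.1).
* C. De Lellis, L. Székelyhidi Jr., *The Euler equations as a differential inclusion*, Ann. of
  Math. 170 (2009), §1 eq. (2) (weak solutions).
-/

open MeasureTheory Set Topology Filter
open scoped InnerProductSpace ContDiff ENNReal

noncomputable section

namespace Literature.Analysis.FluidPDE

namespace Torus

variable {d : Type*} [Fintype d] [DecidableEq d]

/-! ## Tensor fields and their divergence -/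

section Tensor

/-- The divergence of a `2`-tensor field on `T^d` stored by columns,
`S : T^d → (d → ℝ^d)` with `S x j = S(x) eⱼ` the `j`-th column: the vector field
`div S (x) = ∑ⱼ ∂ⱼ (S · j) (x)`, i.e. `(div S)ᵢ = ∑ⱼ ∂ⱼ Sᵢⱼ` (De Lellis–Székelyhidi 2013, §2;
BDSV 2019, §2.1, the term `div R̊`). [cite: BuckmasterEtAl2018, §2.1] -/
def tensorDivergence (S : UnitAddTorus d → d → EuclideanSpace ℝ d) (x : UnitAddTorus d) :
    EuclideanSpace ℝ d :=
  ∑ j, FunctionSpaces.Torus.partialDeriv j (fun y => S y j) x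

omit [DecidableEq d] in
/-- The columns of a smooth tensor field are smooth vector fields. [folklore] -/
theorem _root_.Literature.Analysis.FunctionSpaces.Torus.IsSmooth.column {S : UnitAddTorus d → d → EuclideanSpace ℝ d} (hS : FunctionSpaces.Torus.IsSmooth S) (j : d) :
    FunctionSpaces.Torus.IsSmooth (fun y => S y j) :=
  hS.comp_clm (ContinuousLinearMap.proj (R := ℝ) (φ := fun _ : d => EuclideanSpace ℝ d) j)

/-- The divergence of a smooth tensor field is a smooth vector field. [folklore] -/
theorem _root_.Literature.Analysis.FunctionSpaces.Torus.IsSmooth.tensorDivergence {S : UnitAddTorus d → d → EuclideanSpace ℝ d} (hS : FunctionSpaces.Torus.IsSmooth S) :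
    FunctionSpaces.Torus.IsSmooth (tensorDivergence S) :=
  ContDiff.sum fun j _ => (hS.column j).partialDeriv j

/-- The divergence of the zero tensor field vanishes. [folklore] -/
@[simp]
theorem tensorDivergence_zero (x : UnitAddTorus d) :
    tensorDivergence (fun (_ : UnitAddTorus d) (_ : d) => (0 : EuclideanSpace ℝ d)) x = 0 := by
  unfold tensorDivergence FunctionSpaces.Torus.partialDeriv FunctionSpaces.Torus.lineDeriv
  simp

/-- Integration by parts of the tensor divergence against a smooth vector field:
`∫ ⟪div S, w⟫ = -∫ ∑ⱼ ⟪S^{(j)}, ∂ⱼ w⟫` (no boundary on the torus; column-wise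
`Torus.integral_inner_partialDeriv_eq_neg`, Evans App. C.2 Thm. 2). [folklore] -/
theorem integral_inner_tensorDivergence {S : UnitAddTorus d → d → EuclideanSpace ℝ d}
    {w : UnitAddTorus d → EuclideanSpace ℝ d} (hS : FunctionSpaces.Torus.IsSmooth S) (hw : FunctionSpaces.Torus.IsSmooth w) :
    ∫ x, ⟪tensorDivergence S x, w x⟫_ℝ = -∫ x, ∑ j, ⟪S x j, FunctionSpaces.Torus.partialDeriv j w x⟫_ℝ := by
  simp_rw [tensorDivergence, sum_inner]
  rw [integral_finsetSum _ fun j _ => (((hS.column j).partialDeriv j).inner hw).integrable,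
    integral_finsetSum _ fun j _ => ((hS.column j).inner (hw.partialDeriv j)).integrable,
    ← Finset.sum_neg_distrib]
  exact Finset.sum_congr rfl fun j _ => FunctionSpaces.Torus.integral_inner_partialDeriv_eq_neg (hS.column j) hw j

end Tensor

/-! ## Classical solutions of the Euler–Reynolds system -/

section EulerReynolds

/-- Smooth (classical) solutions of the **Euler–Reynolds system** on `T^d × S`, `S ⊆ ℝ` a time
set (BDSV 2019, §2.1, system (2.2) with the constraints `tr R̊ = 0`, `∫ p = 0`; De Lellis–
Székelyhidi 2013, Def. 2.1): a velocity `v`, a pressure `p` and a Reynolds stress `R` (a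
`2`-tensor field stored by columns, `R t x j ∈ ℝ^d`), all jointly `C^∞` on `S × T^d`, with
`∂ₜv + (v·∇)v + ∇p = div R`, `div v = 0`, `R` symmetric and trace free, and `p` of zero mean at
every time of `S`. For divergence-free `v`, `(v·∇)v = div (v ⊗ v)`, so the momentum equation is
BDSV's `∂ₜv + div (v ⊗ v) + ∇p = div R̊`. The time derivative is the one-sided
`Torus.timeDerivWithin S` (convention of `Torus.IsClassicalNSSolutionOn`). For `R = 0` (and
then `p` normalised) these are classical Euler solutions. [cite: BuckmasterEtAl2018, §2.1] -/
structure IsEulerReynoldsOn (S : Set ℝ) (v : ℝ → UnitAddTorus d → EuclideanSpace ℝ d)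
    (p : ℝ → UnitAddTorus d → ℝ) (R : ℝ → UnitAddTorus d → d → EuclideanSpace ℝ d) : Prop where
  /-- The velocity is jointly smooth on `S × T^d`. -/
  smooth_velocity : FunctionSpaces.Torus.IsSmoothSpaceTimeOn S v
  /-- The pressure is jointly smooth on `S × T^d`. -/
  smooth_pressure : FunctionSpaces.Torus.IsSmoothSpaceTimeOn S p
  /-- The Reynolds stress is jointly smooth on `S × T^d`. -/
  smooth_stress : FunctionSpaces.Torus.IsSmoothSpaceTimeOn S R
  /-- The momentum equation `∂ₜv + (v·∇)v + ∇p = div R` holds pointwise on `S × T^d`. -/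
  momentum : ∀ t ∈ S, ∀ x,
    FunctionSpaces.Torus.timeDerivWithin S v t x + FunctionSpaces.Torus.convect (v t) (v t) x + FunctionSpaces.Torus.gradient (p t) x = tensorDivergence (R t) x
  /-- Incompressibility `div v(t) = 0` for `t ∈ S`. -/
  divFree : ∀ t ∈ S, FunctionSpaces.Torus.IsDivFree (v t)
  /-- The Reynolds stress is symmetric. -/
  symm : ∀ t ∈ S, ∀ x, ∀ i j : d, R t x i j = R t x j i
  /-- The Reynolds stress is trace free, `tr R = 0`. -/
  traceFree : ∀ t ∈ S, ∀ x, ∑ i, R t x i i = 0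
  /-- The pressure has zero mean, `∫ p(t) = 0` (this normalisation determines it uniquely). -/
  hasZeroMean_pressure : ∀ t ∈ S, FunctionSpaces.Torus.HasZeroMean (p t)

omit [Fintype d] [DecidableEq d] in
/-- The one-sided time derivative of the zero field vanishes. [folklore] -/
@[simp]
theorem timeDerivWithin_zero {F : Type*} [NormedAddCommGroup F] [NormedSpace ℝ F] (S : Set ℝ)
    (t : ℝ) (x : UnitAddTorus d) :
    FunctionSpaces.Torus.timeDerivWithin S (fun (_ : ℝ) (_ : UnitAddTorus d) => (0 : F)) t x = 0 := by
  simp [FunctionSpaces.Torus.timeDerivWithin]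

omit [Fintype d] [DecidableEq d] in
/-- The convective derivative of the zero field vanishes. [folklore] -/
@[simp]
theorem convect_zero_right {F : Type*} [NormedAddCommGroup F] [NormedSpace ℝ F]
    (u : UnitAddTorus d → EuclideanSpace ℝ d) (x : UnitAddTorus d) :
    FunctionSpaces.Torus.convect u (fun _ : UnitAddTorus d => (0 : F)) x = 0 := by
  unfold FunctionSpaces.Torus.convect FunctionSpaces.Torus.fderiv FunctionSpaces.Torus.liftAt
  simp

omit [DecidableEq d] in
/-- The gradient of the zero function vanishes. [folklore] -/
@[simp]
theorem gradient_zero (x : UnitAddTorus d) :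
    FunctionSpaces.Torus.gradient (fun _ : UnitAddTorus d => (0 : ℝ)) x = 0 := by
  unfold FunctionSpaces.Torus.gradient FunctionSpaces.Torus.liftAt
  simp [_root_.gradient]

/-- The divergence of the zero field vanishes. [folklore] -/
@[simp]
theorem divergence_zero (x : UnitAddTorus d) :
    FunctionSpaces.Torus.divergence (fun _ : UnitAddTorus d => (0 : EuclideanSpace ℝ d)) x = 0 := by
  unfold FunctionSpaces.Torus.divergence FunctionSpaces.Torus.partialDeriv FunctionSpaces.Torus.lineDeriv
  simp

/-- The zero triple `(v, p, R) = (0, 0, 0)` solves the Euler–Reynolds system on every time set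
(the starting point of the BDSV iteration, §2.2: "we apply Proposition 2.1 iteratively with
`(v₀, R₀, p₀) = (0, 0, 0)`"). [cite: BuckmasterEtAl2018, §2.2] -/
theorem isEulerReynoldsOn_zero (S : Set ℝ) :
    IsEulerReynoldsOn (d := d) S (fun _ _ => 0) (fun _ _ => 0) (fun _ _ _ => 0) where
  smooth_velocity := contDiffOn_const
  smooth_pressure := contDiffOn_const
  smooth_stress := contDiffOn_const
  momentum t _ x := by simp
  divFree t _ x := by simp
  symm _ _ _ _ _ := rfl
  traceFree _ _ _ := by simp
  hasZeroMean_pressure _ _ := by simp [FunctionSpaces.Torus.HasZeroMean]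

variable {S : Set ℝ} {T : ℝ} {v : ℝ → UnitAddTorus d → EuclideanSpace ℝ d}
  {p : ℝ → UnitAddTorus d → ℝ} {R : ℝ → UnitAddTorus d → d → EuclideanSpace ℝ d}

omit [DecidableEq d] in
/-- The columns of a jointly smooth tensor field are jointly smooth. [folklore] -/
theorem _root_.Literature.Analysis.FunctionSpaces.Torus.IsSmoothSpaceTimeOn.column (hR : FunctionSpaces.Torus.IsSmoothSpaceTimeOn S R) (j : d) :
    FunctionSpaces.Torus.IsSmoothSpaceTimeOn S (fun t x => R t x j) :=
  hR.clm_comp (ContinuousLinearMap.proj (R := ℝ) (φ := fun _ : d => EuclideanSpace ℝ d) j)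

/-- An Euler–Reynolds solution on `S` is one on every interval `[0, T] ⊆ S` with `0 < T`
(one-sided time derivatives within `[0, T]` and within `S` agree on `[0, T]`). [folklore] -/
theorem IsEulerReynoldsOn.mono_Icc (h : IsEulerReynoldsOn S v p R) (hS : Icc 0 T ⊆ S)
    (hT : 0 < T) : IsEulerReynoldsOn (Icc 0 T) v p R where
  smooth_velocity := h.smooth_velocity.mono hS
  smooth_pressure := h.smooth_pressure.mono hS
  smooth_stress := h.smooth_stress.mono hS
  momentum t ht x := by
    have h1 : FunctionSpaces.Torus.timeDerivWithin (Icc 0 T) v t x = FunctionSpaces.Torus.timeDerivWithin S v t x := by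
      have hd : HasDerivWithinAt (fun τ => v τ x) (FunctionSpaces.Torus.timeDerivWithin S v t x) (Icc 0 T) t :=
        ((h.smooth_velocity.hasDerivWithinAt_slice (hS ht) x)).mono hS
      exact hd.derivWithin (uniqueDiffOn_Icc hT t ht)
    rw [h1]
    exact h.momentum t (hS ht) x
  divFree t ht := h.divFree t (hS ht)
  symm t ht := h.symm t (hS ht)
  traceFree t ht := h.traceFree t (hS ht)
  hasZeroMean_pressure t ht := h.hasZeroMean_pressure t (hS ht)

/-- **Classical Euler–Reynolds solutions are weak Euler solutions up to the Reynolds defect.**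
For a classical solution of the Euler–Reynolds system on a time set `S ⊇ [0, T]` and every
smooth divergence-free test field `ψ` compactly supported in time in `(0, T)`,
`∫₀ᵀ ∫ (⟪v, ∂ₜψ⟫ + ⟪v, (v·∇)ψ⟫) dx dt = ∫₀ᵀ ∫ ∑ⱼ ⟪R^{(j)}, ∂ⱼψ⟫ dx dt`.
Proof (the standard remark that classical solutions are distributional ones, as in
`Torus.IsClassicalNSSolutionOn.isWeakNSSolutionOn_holds`): `E(t) = ∫ ⟪v(t), ψ(t)⟫` vanishes at
`t = 0, T`, and `E' = ∫ (⟪v, ∂ₜψ⟫ + ⟪div R - ∇p - (v·∇)v, ψ⟫)`; on the torus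
`∫ ⟪∇p, ψ⟫ = 0` (`div ψ = 0`), `∫ ⟪(v·∇)v, ψ⟫ = -∫ ⟪v, (v·∇)ψ⟫` (`div v = 0`) and
`∫ ⟪div R, ψ⟫ = -∫ ∑ⱼ ⟪R^{(j)}, ∂ⱼψ⟫`; integrate `E'` over `[0, T]`
(BDSV 2019, §2.2: "Since `R̊_q → 0` uniformly, the pair `(v, p)` solves the Euler equations";
De Lellis–Székelyhidi 2009, §1 eq. (2)). [cite: BuckmasterEtAl2018, §2.2] -/
theorem IsEulerReynoldsOn.weak_identity (h : IsEulerReynoldsOn S v p R) (hS : Icc 0 T ⊆ S)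
    {ψ : ℝ → UnitAddTorus d → EuclideanSpace ℝ d} (hψ : FunctionSpaces.Torus.IsSpaceTimeTestIoo T ψ)
    (hψdiv : FunctionSpaces.Torus.IsDivFreeTest ψ) :
    ∫ t in Ioo 0 T, ∫ x, (⟪v t x, FunctionSpaces.Torus.timeDeriv ψ t x⟫_ℝ + ⟪v t x, FunctionSpaces.Torus.convect (v t) (ψ t) x⟫_ℝ) =
      ∫ t in Ioo 0 T, ∫ x, ∑ j, ⟪R t x j, FunctionSpaces.Torus.partialDeriv j (ψ t) x⟫_ℝ := by
  rcases le_or_gt T 0 with hT | hT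
  · simp [Ioo_eq_empty (not_lt.2 hT)]
  -- restrict to the time interval `I = [0, T]`
  have hI := h.mono_Icc hS hT
  obtain ⟨⟨hψs, T', hT'T, hT'⟩, ε, hε, hε0⟩ := id hψ
  set I : Set ℝ := Icc 0 T with hI_def
  have hU : UniqueDiffOn ℝ I := uniqueDiffOn_Icc hT
  have hv : FunctionSpaces.Torus.IsSmoothSpaceTimeOn I v := hI.smooth_velocity
  have hp : FunctionSpaces.Torus.IsSmoothSpaceTimeOn I p := hI.smooth_pressure
  have hR : FunctionSpaces.Torus.IsSmoothSpaceTimeOn I R := hI.smooth_stress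
  have hψI : FunctionSpaces.Torus.IsSmoothSpaceTimeOn I ψ := hψs.contDiffOn
  have hψ'I : FunctionSpaces.Torus.IsSmoothSpaceTimeOn I (FunctionSpaces.Torus.timeDeriv ψ) := hψ.1.timeDeriv.1.contDiffOn
  -- the pairing `E(t) = ∫ ⟪v(t), ψ(t)⟫` and its derivative within `I`
  have hg : FunctionSpaces.Torus.IsSmoothSpaceTimeOn I (fun t x => ⟪v t x, ψ t x⟫_ℝ) := hv.inner hψI
  set E : ℝ → ℝ := fun t => ∫ x, ⟪v t x, ψ t x⟫_ℝ with hE_def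
  set E' : ℝ → ℝ := fun t => ∫ x, FunctionSpaces.Torus.timeDerivWithin I (fun t x => ⟪v t x, ψ t x⟫_ℝ) t x
    with hE'_def
  have hE : ∀ t ∈ I, HasDerivWithinAt E (E' t) I t := fun t ht =>
    hg.hasDerivWithinAt_integral (convex_Icc 0 T) ht
  have hE'cont : ContinuousOn E' I := hg.continuousOn_integral_timeDerivWithin hU
  have hE0 : E 0 = 0 := by
    simp only [hE_def, hε0 0 hε.le, Pi.zero_apply, inner_zero_right, integral_zero]
  have hET : E T = 0 := by
    simp only [hE_def, hT' T hT'T.le, Pi.zero_apply, inner_zero_right, integral_zero]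
  have hFTC : ∫ t in Ioo 0 T, E' t = 0 := by
    rw [← integral_Ioc_eq_integral_Ioo, ← intervalIntegral.integral_of_le hT.le,
      intervalIntegral.integral_eq_sub_of_hasDerivAt_of_le hT.le
        (fun t ht => (hE t ht).continuousWithinAt)
        (fun t ht => (hE t (Ioo_subset_Icc_self ht)).hasDerivAt (Icc_mem_nhds ht.1 ht.2))
        ((hE'cont.mono (uIcc_of_le hT.le).subset).intervalIntegrable),
      hET, hE0, sub_zero]
  -- the two space-integrated sides, continuous in time on `I`
  set A : ℝ → ℝ := fun t =>
    ∫ x, (⟪v t x, FunctionSpaces.Torus.timeDeriv ψ t x⟫_ℝ + ⟪v t x, FunctionSpaces.Torus.convect (v t) (ψ t) x⟫_ℝ) with hA_def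
  set B : ℝ → ℝ := fun t => ∫ x, ∑ j, ⟪R t x j, FunctionSpaces.Torus.partialDeriv j (ψ t) x⟫_ℝ with hB_def
  have hAsm : FunctionSpaces.Torus.IsSmoothSpaceTimeOn I
      (fun t x => ⟪v t x, FunctionSpaces.Torus.timeDeriv ψ t x⟫_ℝ + ⟪v t x, FunctionSpaces.Torus.convect (v t) (ψ t) x⟫_ℝ) :=
    (hv.inner hψ'I).add (hv.inner (hv.convect hψI hU))
  have hBsm : FunctionSpaces.Torus.IsSmoothSpaceTimeOn I (fun t x => ∑ j, ⟪R t x j, FunctionSpaces.Torus.partialDeriv j (ψ t) x⟫_ℝ) :=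
    FunctionSpaces.Torus.IsSmoothSpaceTimeOn.sum fun j _ => (hR.column j).inner (hψI.partialDeriv hU j)
  have hAcont : ContinuousOn A I := hAsm.continuousOn_integral (convex_Icc 0 T)
  have hBcont : ContinuousOn B I := hBsm.continuousOn_integral (convex_Icc 0 T)
  have hAint : IntegrableOn A (Ioo 0 T) volume :=
    (hAcont.integrableOn_compact isCompact_Icc).mono_set Ioo_subset_Icc_self
  have hBint : IntegrableOn B (Ioo 0 T) volume :=
    (hBcont.integrableOn_compact isCompact_Icc).mono_set Ioo_subset_Icc_self
  -- pointwise in time: `E' t = A t - B t` on `(0, T)`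
  have hkey : ∀ t ∈ Ioo 0 T, E' t = A t - B t := by
    intro t ht
    have htI : t ∈ I := Ioo_subset_Icc_self ht
    have hvt : FunctionSpaces.Torus.IsSmooth (v t) := hv.isSmooth_slice htI
    have hpt : FunctionSpaces.Torus.IsSmooth (p t) := hp.isSmooth_slice htI
    have hRt : FunctionSpaces.Torus.IsSmooth (R t) := hR.isSmooth_slice htI
    have hψt : FunctionSpaces.Torus.IsSmooth (ψ t) := hψI.isSmooth_slice htI
    have hψ't : FunctionSpaces.Torus.IsSmooth (FunctionSpaces.Torus.timeDeriv ψ t) := hψ.1.timeDeriv.isSmooth_slice t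
    -- `∂ₜ⟪v, ψ⟫ = ⟪v, ∂ₜψ⟫ + ⟪div R - ∇p - (v·∇)v, ψ⟫`
    have hslice : ∀ x, FunctionSpaces.Torus.timeDerivWithin I (fun t x => ⟪v t x, ψ t x⟫_ℝ) t x =
        ⟪v t x, FunctionSpaces.Torus.timeDeriv ψ t x⟫_ℝ +
          ⟪tensorDivergence (R t) x - FunctionSpaces.Torus.gradient (p t) x - FunctionSpaces.Torus.convect (v t) (v t) x, ψ t x⟫_ℝ := by
      intro x
      have h1 : HasDerivWithinAt (fun τ => v τ x) (FunctionSpaces.Torus.timeDerivWithin I v t x) I t :=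
        hv.hasDerivWithinAt_slice htI x
      have h2 : HasDerivWithinAt (fun τ => ψ τ x) (FunctionSpaces.Torus.timeDeriv ψ t x) I t := by
        obtain ⟨y, rfl⟩ := FunctionSpaces.Torus.proj_surjective x
        have hd : Differentiable ℝ (fun τ : ℝ => FunctionSpaces.Torus.stLift ψ (τ, y)) :=
          (hψs.differentiable (by simp)).comp (differentiable_id.prodMk (differentiable_const y))
        exact (hd t).hasDerivAt.hasDerivWithinAt
      have h12 := (h1.inner ℝ h2).derivWithin (hU t htI)
      have hm := hI.momentum t htI x
      have h3 : FunctionSpaces.Torus.timeDerivWithin I v t x =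
          tensorDivergence (R t) x - FunctionSpaces.Torus.gradient (p t) x - FunctionSpaces.Torus.convect (v t) (v t) x := by
        rw [← hm]; abel
      rw [FunctionSpaces.Torus.timeDerivWithin, h12, h3]
    have i1 : Integrable (fun x => ⟪v t x, FunctionSpaces.Torus.timeDeriv ψ t x⟫_ℝ) volume :=
      (hvt.inner hψ't).integrable
    have i2 : Integrable (fun x => ⟪v t x, FunctionSpaces.Torus.convect (v t) (ψ t) x⟫_ℝ) volume :=
      (hvt.inner (hvt.convect hψt)).integrable
    have iD : Integrable (fun x => ⟪tensorDivergence (R t) x, ψ t x⟫_ℝ) volume :=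
      (hRt.tensorDivergence.inner hψt).integrable
    have iG : Integrable (fun x => ⟪FunctionSpaces.Torus.gradient (p t) x, ψ t x⟫_ℝ) volume :=
      (hpt.gradient.inner hψt).integrable
    have iC : Integrable (fun x => ⟪FunctionSpaces.Torus.convect (v t) (v t) x, ψ t x⟫_ℝ) volume :=
      ((hvt.convect hvt).inner hψt).integrable
    have hgrad : ∫ x, ⟪FunctionSpaces.Torus.gradient (p t) x, ψ t x⟫_ℝ = 0 :=
      FunctionSpaces.Torus.integral_inner_gradient_eq_zero_of_isDivFree hψt hpt (hψdiv t)
    have hconv : ∫ x, ⟪FunctionSpaces.Torus.convect (v t) (v t) x, ψ t x⟫_ℝ =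
        -∫ x, ⟪v t x, FunctionSpaces.Torus.convect (v t) (ψ t) x⟫_ℝ :=
      FunctionSpaces.Torus.integral_inner_convect_eq_neg hvt (hI.divFree t htI) hvt hψt
    have iDG : Integrable (fun x => ⟪tensorDivergence (R t) x, ψ t x⟫_ℝ -
        ⟪FunctionSpaces.Torus.gradient (p t) x, ψ t x⟫_ℝ) volume := iD.sub iG
    have iDGC : Integrable (fun x => ⟪tensorDivergence (R t) x, ψ t x⟫_ℝ -
        ⟪FunctionSpaces.Torus.gradient (p t) x, ψ t x⟫_ℝ - ⟪FunctionSpaces.Torus.convect (v t) (v t) x, ψ t x⟫_ℝ) volume := iDG.sub iC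
    have hdivR : ∫ x, ⟪tensorDivergence (R t) x, ψ t x⟫_ℝ = -B t :=
      integral_inner_tensorDivergence hRt hψt
    simp only [hE'_def, hA_def]
    simp_rw [hslice, inner_sub_left]
    rw [integral_add i1 iDGC, integral_sub iDG iC, integral_sub iD iG,
      hgrad, hconv, hdivR, integral_add i1 i2]
    ring
  -- integrate in time
  have h0 : ∫ t in Ioo 0 T, (A t - B t) = 0 :=
    (setIntegral_congr_fun measurableSet_Ioo fun t ht => (hkey t ht).symm).trans hFTC
  have h1 : (∫ t in Ioo 0 T, A t) - ∫ t in Ioo 0 T, B t = 0 := by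
    rw [← integral_sub hAint hBint, h0]
  exact sub_eq_zero.1 h1

/-- The Reynolds defect is controlled by the stress: if `‖R t x‖ ≤ η` on `(0, T) × T^d` and
`‖∂ⱼ ψ(t) x‖ ≤ K` for all `j` on `(0, T) × T^d`, then
`|∫₀ᵀ ∫ ∑ⱼ ⟪R^{(j)}, ∂ⱼψ⟫| ≤ T · card d · η · K` (so the defect of the BDSV sequence tends to
`0` with `‖R̊_q‖₀`; BDSV 2019, §2.2). [cite: BuckmasterEtAl2018, §2.2] -/
theorem norm_integral_reynoldsDefect_le (hT : 0 ≤ T) {η K : ℝ} (hη : 0 ≤ η)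
    (hRb : ∀ t ∈ Ioo 0 T, ∀ x, ‖R t x‖ ≤ η)
    {ψ : ℝ → UnitAddTorus d → EuclideanSpace ℝ d}
    (hψb : ∀ t ∈ Ioo 0 T, ∀ x, ∀ j, ‖FunctionSpaces.Torus.partialDeriv j (ψ t) x‖ ≤ K) :
    ‖∫ t in Ioo 0 T, ∫ x, ∑ j, ⟪R t x j, FunctionSpaces.Torus.partialDeriv j (ψ t) x⟫_ℝ‖ ≤
      T * (Fintype.card d * (η * K)) := by
  have hpt : ∀ t ∈ Ioo 0 T, ∀ x, ‖∑ j, ⟪R t x j, FunctionSpaces.Torus.partialDeriv j (ψ t) x⟫_ℝ‖ ≤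
      Fintype.card d * (η * K) := by
    intro t ht x
    calc ‖∑ j, ⟪R t x j, FunctionSpaces.Torus.partialDeriv j (ψ t) x⟫_ℝ‖
        ≤ ∑ j, ‖⟪R t x j, FunctionSpaces.Torus.partialDeriv j (ψ t) x⟫_ℝ‖ := norm_sum_le _ _
      _ ≤ ∑ _j : d, η * K := Finset.sum_le_sum fun j _ => by
          calc ‖⟪R t x j, FunctionSpaces.Torus.partialDeriv j (ψ t) x⟫_ℝ‖ ≤ ‖R t x j‖ * ‖FunctionSpaces.Torus.partialDeriv j (ψ t) x‖ :=
                norm_inner_le_norm _ _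
            _ ≤ η * K := mul_le_mul ((norm_le_pi_norm (R t x) j).trans (hRb t ht x))
                (hψb t ht x j) (norm_nonneg _) hη
      _ = Fintype.card d * (η * K) := by simp
  have hslice : ∀ t ∈ Ioo 0 T, ‖∫ x, ∑ j, ⟪R t x j, FunctionSpaces.Torus.partialDeriv j (ψ t) x⟫_ℝ‖ ≤
      Fintype.card d * (η * K) := by
    intro t ht
    calc ‖∫ x, ∑ j, ⟪R t x j, FunctionSpaces.Torus.partialDeriv j (ψ t) x⟫_ℝ‖
        ≤ (Fintype.card d * (η * K)) * (volume : Measure (UnitAddTorus d)).real univ :=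
          norm_integral_le_of_norm_le_const (ae_of_all _ fun x => hpt t ht x)
      _ = Fintype.card d * (η * K) := by simp
  calc ‖∫ t in Ioo 0 T, ∫ x, ∑ j, ⟪R t x j, FunctionSpaces.Torus.partialDeriv j (ψ t) x⟫_ℝ‖
      ≤ (Fintype.card d * (η * K)) * (volume : Measure ℝ).real (Ioo 0 T) :=
        norm_setIntegral_le_of_norm_le_const (by rw [Real.volume_Ioo]; exact ENNReal.ofReal_lt_top)
          hslice
    _ = T * (Fintype.card d * (η * K)) := by
        rw [Measure.real, Real.volume_Ioo, ENNReal.toReal_ofReal (by linarith)]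
        ring

end EulerReynolds

/-! ## Scaling: `(v, p, R)(t, x) ↦ (c v, c² p, c² R)(c t, x)` -/

section Scaling

variable {T c : ℝ} {v : ℝ → UnitAddTorus d → EuclideanSpace ℝ d}
  {p : ℝ → UnitAddTorus d → ℝ} {R : ℝ → UnitAddTorus d → d → EuclideanSpace ℝ d}

omit [DecidableEq d] in
/-- The gradient is linear: `∇(c θ) = c ∇θ` for `C¹` scalar `θ`. [folklore] -/
theorem gradient_const_smul {θ : UnitAddTorus d → ℝ} (hθ : FunctionSpaces.Torus.IsContDiff 1 θ) (c : ℝ)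
    (x : UnitAddTorus d) : FunctionSpaces.Torus.gradient (c • θ) x = c • FunctionSpaces.Torus.gradient θ x := by
  refine ext_inner_right ℝ fun w => ?_
  rw [FunctionSpaces.Torus.inner_gradient_left, FunctionSpaces.Torus.fderiv_const_smul hθ, real_inner_smul_left, FunctionSpaces.Torus.inner_gradient_left]
  rfl

/-- The divergence is linear: `div (c u) = c div u` for `C¹` vector fields. [folklore] -/
theorem divergence_const_smul {u : UnitAddTorus d → EuclideanSpace ℝ d} (hu : FunctionSpaces.Torus.IsContDiff 1 u)
    (c : ℝ) (x : UnitAddTorus d) : FunctionSpaces.Torus.divergence (c • u) x = c * FunctionSpaces.Torus.divergence u x := by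
  unfold FunctionSpaces.Torus.divergence
  rw [Finset.mul_sum]
  refine Finset.sum_congr rfl fun i _ => ?_
  have hui : FunctionSpaces.Torus.IsContDiff 1 (fun y => u y i) :=
    (EuclideanSpace.proj i : EuclideanSpace ℝ d →L[ℝ] ℝ).contDiff.comp hu
  have h : (fun y => (c • u) y i) = c • fun y => u y i := by
    funext y; simp
  rw [h, FunctionSpaces.Torus.partialDeriv_const_smul hui]
  rfl

/-- The tensor divergence is linear: `div (c S) = c div S` for `C¹` tensor fields. [folklore] -/
theorem tensorDivergence_const_smul {S : UnitAddTorus d → d → EuclideanSpace ℝ d}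
    (hS : FunctionSpaces.Torus.IsContDiff 1 S) (c : ℝ) (x : UnitAddTorus d) :
    tensorDivergence (c • S) x = c • tensorDivergence S x := by
  unfold tensorDivergence
  rw [Finset.smul_sum]
  refine Finset.sum_congr rfl fun j _ => ?_
  have hSj : FunctionSpaces.Torus.IsContDiff 1 (fun y => S y j) :=
    (ContinuousLinearMap.proj (R := ℝ) (φ := fun _ : d => EuclideanSpace ℝ d) j).contDiff.comp hS
  have h : (fun y => (c • S) y j) = c • fun y => S y j := by
    funext y; simp
  rw [h, FunctionSpaces.Torus.partialDeriv_const_smul hSj]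
  rfl

omit [DecidableEq d] in
/-- Joint smoothness is preserved by the time rescaling `(t, x) ↦ w (c t) x` from `[0, T]` to
`[0, T/c]`, `c > 0`. [folklore] -/
theorem _root_.Literature.Analysis.FunctionSpaces.Torus.IsSmoothSpaceTimeOn.comp_mul_time {F : Type*} [NormedAddCommGroup F] [NormedSpace ℝ F]
    {w : ℝ → UnitAddTorus d → F} (hw : FunctionSpaces.Torus.IsSmoothSpaceTimeOn (Icc 0 T) w) (hc : 0 < c) :
    FunctionSpaces.Torus.IsSmoothSpaceTimeOn (Icc 0 (T / c)) (fun t x => w (c * t) x) := by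
  have hφ : ContDiff ℝ ∞ (fun z : ℝ × EuclideanSpace ℝ d => ((c * z.1, z.2) : ℝ × EuclideanSpace ℝ d)) :=
    (contDiff_const.mul contDiff_fst).prodMk contDiff_snd
  have hmaps : MapsTo (fun z : ℝ × EuclideanSpace ℝ d => ((c * z.1, z.2) : ℝ × EuclideanSpace ℝ d))
      (Icc 0 (T / c) ×ˢ univ) (Icc 0 T ×ˢ univ) := by
    rintro ⟨t, y⟩ hz
    obtain ⟨⟨ht0, htT⟩, -⟩ := mem_prod.1 hz
    refine mk_mem_prod ⟨mul_nonneg hc.le ht0, ?_⟩ (mem_univ _)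
    calc c * t ≤ c * (T / c) := mul_le_mul_of_nonneg_left htT hc.le
      _ = T := mul_div_cancel₀ T hc.ne'
  exact hw.comp hφ.contDiffOn hmaps

/-- **Scaling invariance of the Euler–Reynolds system.** If `(v, p, R)` solves Euler–Reynolds
on `[0, T] × T^d` and `c > 0`, then `(t, x) ↦ (c v(c t, x), c² p(c t, x), c² R(c t, x))` solves
it on `[0, T/c] × T^d` (BDSV 2019, §2.2: "the Euler equations are invariant under the
transformation `v(x,t) ↦ Γ v(x, Γ t)`, `p(x,t) ↦ Γ² p(x, Γ t)`", used to normalise the energy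
profile). [cite: BuckmasterEtAl2018, §2.2] -/
theorem IsEulerReynoldsOn.timeRescale (h : IsEulerReynoldsOn (Icc 0 T) v p R) (hT : 0 < T)
    (hc : 0 < c) :
    IsEulerReynoldsOn (Icc 0 (T / c)) (fun t x => c • v (c * t) x)
      (fun t x => c ^ 2 * p (c * t) x) (fun t x => c ^ 2 • R (c * t) x) where
  smooth_velocity := (h.smooth_velocity.comp_mul_time hc).const_smul c
  smooth_pressure := by
    have := (h.smooth_pressure.comp_mul_time hc).const_smul (c ^ 2)
    simpa only [smul_eq_mul] using this
  smooth_stress := (h.smooth_stress.comp_mul_time hc).const_smul (c ^ 2)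
  momentum t ht x := by
    have hTc : 0 < T / c := div_pos hT hc
    have hct : c * t ∈ Icc 0 T := by
      refine ⟨mul_nonneg hc.le ht.1, ?_⟩
      calc c * t ≤ c * (T / c) := mul_le_mul_of_nonneg_left ht.2 hc.le
        _ = T := mul_div_cancel₀ T hc.ne'
    have hvs : FunctionSpaces.Torus.IsSmooth (v (c * t)) := h.smooth_velocity.isSmooth_slice hct
    have hps : FunctionSpaces.Torus.IsSmooth (p (c * t)) := h.smooth_pressure.isSmooth_slice hct
    have hRs : FunctionSpaces.Torus.IsSmooth (R (c * t)) := h.smooth_stress.isSmooth_slice hct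
    -- time derivative: chain rule along `τ ↦ c τ`
    have h1 : FunctionSpaces.Torus.timeDerivWithin (Icc 0 (T / c)) (fun t x => c • v (c * t) x) t x =
        c • (c • FunctionSpaces.Torus.timeDerivWithin (Icc 0 T) v (c * t) x) := by
      have hg : HasDerivWithinAt (fun τ => v τ x) (FunctionSpaces.Torus.timeDerivWithin (Icc 0 T) v (c * t) x)
          (Icc 0 T) (c * t) := h.smooth_velocity.hasDerivWithinAt_slice hct x
      have hh : HasDerivWithinAt (fun τ : ℝ => c * τ) c (Icc 0 (T / c)) t := by
        simpa using (hasDerivWithinAt_id t (Icc 0 (T / c))).const_mul c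
      have hmaps : MapsTo (fun τ : ℝ => c * τ) (Icc 0 (T / c)) (Icc 0 T) := by
        intro τ hτ
        refine ⟨mul_nonneg hc.le hτ.1, ?_⟩
        calc c * τ ≤ c * (T / c) := mul_le_mul_of_nonneg_left hτ.2 hc.le
          _ = T := mul_div_cancel₀ T hc.ne'
      have hcomp := (hg.scomp t hh hmaps).const_smul c
      exact hcomp.derivWithin (uniqueDiffOn_Icc hTc t ht)
    have h2 : FunctionSpaces.Torus.convect (fun x => c • v (c * t) x) (fun x => c • v (c * t) x) x =
        c • (c • FunctionSpaces.Torus.convect (v (c * t)) (v (c * t)) x) := by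
      change FunctionSpaces.Torus.fderiv (c • v (c * t)) x (c • v (c * t) x) = _
      rw [FunctionSpaces.Torus.fderiv_const_smul (hvs.isContDiff (by simp)), FunLike.coe_smul, Pi.smul_apply,
        map_smul]
      rfl
    have h3 : FunctionSpaces.Torus.gradient (fun x => c ^ 2 * p (c * t) x) x = c ^ 2 • FunctionSpaces.Torus.gradient (p (c * t)) x := by
      change FunctionSpaces.Torus.gradient (c ^ 2 • p (c * t)) x = _
      exact gradient_const_smul (hps.isContDiff (by simp)) _ _
    have h4 : tensorDivergence (fun x => c ^ 2 • R (c * t) x) x =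
        c ^ 2 • tensorDivergence (R (c * t)) x := by
      change tensorDivergence (c ^ 2 • R (c * t)) x = _
      exact tensorDivergence_const_smul (hRs.isContDiff (by simp)) _ _
    rw [h1, h2, h3, h4, ← h.momentum (c * t) hct x, smul_smul, smul_smul, ← pow_two, smul_add,
      smul_add]
  divFree t ht x := by
    have hct : c * t ∈ Icc 0 T := by
      refine ⟨mul_nonneg hc.le ht.1, ?_⟩
      calc c * t ≤ c * (T / c) := mul_le_mul_of_nonneg_left ht.2 hc.le
        _ = T := mul_div_cancel₀ T hc.ne'
    have hvs : FunctionSpaces.Torus.IsSmooth (v (c * t)) := h.smooth_velocity.isSmooth_slice hct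
    change FunctionSpaces.Torus.divergence (c • v (c * t)) x = 0
    rw [divergence_const_smul (hvs.isContDiff (by simp)), h.divFree (c * t) hct x, mul_zero]
  symm t ht x i j := by
    have hct : c * t ∈ Icc 0 T := by
      refine ⟨mul_nonneg hc.le ht.1, ?_⟩
      calc c * t ≤ c * (T / c) := mul_le_mul_of_nonneg_left ht.2 hc.le
        _ = T := mul_div_cancel₀ T hc.ne'
    simp only [Pi.smul_apply, PiLp.smul_apply, smul_eq_mul]
    rw [h.symm (c * t) hct x i j]
  traceFree t ht x := by
    have hct : c * t ∈ Icc 0 T := by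
      refine ⟨mul_nonneg hc.le ht.1, ?_⟩
      calc c * t ≤ c * (T / c) := mul_le_mul_of_nonneg_left ht.2 hc.le
        _ = T := mul_div_cancel₀ T hc.ne'
    simp only [Pi.smul_apply, PiLp.smul_apply, smul_eq_mul, ← Finset.mul_sum,
      h.traceFree (c * t) hct x, mul_zero]
  hasZeroMean_pressure t ht := by
    have hct : c * t ∈ Icc 0 T := by
      refine ⟨mul_nonneg hc.le ht.1, ?_⟩
      calc c * t ≤ c * (T / c) := mul_le_mul_of_nonneg_left ht.2 hc.le
        _ = T := mul_div_cancel₀ T hc.ne'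
    have h0 := h.hasZeroMean_pressure (c * t) hct
    unfold FunctionSpaces.Torus.HasZeroMean at h0 ⊢
    rw [integral_const_mul, h0, mul_zero]

end Scaling

/-! ## Uniform limits of Euler–Reynolds solutions with vanishing stress -/

section Limit

variable {F : Type*} [NormedAddCommGroup F]

omit [Fintype d] [DecidableEq d] in
/-- A uniform limit (on `S × T^d`) of fields whose space–time lifts are continuous on `S × ℝ^d`
has a space–time lift continuous on `S × ℝ^d`. [folklore] -/
theorem continuousOn_stLift_of_unifLimit {S : Set ℝ} {w : ℕ → ℝ → UnitAddTorus d → F}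
    {u : ℝ → UnitAddTorus d → F} (hw : ∀ q, ContinuousOn (FunctionSpaces.Torus.stLift (w q)) (S ×ˢ univ))
    (hlim : ∀ ε > 0, ∃ N, ∀ q ≥ N, ∀ t ∈ S, ∀ x, ‖w q t x - u t x‖ ≤ ε) :
    ContinuousOn (FunctionSpaces.Torus.stLift u) (S ×ˢ univ) := by
  refine TendstoUniformlyOn.continuousOn (F := fun q => FunctionSpaces.Torus.stLift (w q)) (p := atTop) ?_
    (Eventually.of_forall hw).frequently
  rw [Metric.tendstoUniformlyOn_iff]
  intro ε hε
  obtain ⟨N, hN⟩ := hlim (ε / 2) (half_pos hε)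
  filter_upwards [eventually_ge_atTop N] with q hq
  rintro ⟨t, y⟩ hz
  rw [dist_eq_norm, FunctionSpaces.Torus.stLift_apply, FunctionSpaces.Torus.stLift_apply, norm_sub_rev]
  exact (hN q hq t (mem_prod.1 hz).1 (FunctionSpaces.Torus.proj y)).trans_lt (half_lt_self hε)

omit [DecidableEq d] in
/-- Pointwise stability of the weak-Euler integrand `⟪a, P⟫ + ⟪a, ∑ᵢ aᵢ Dᵢ⟫` (the second term is
`⟪a, (a·∇)ψ⟫` with `Dᵢ = ∂ᵢψ`): it is locally Lipschitz in `a`, with constant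
`‖P‖ + card d · maxᵢ ‖Dᵢ‖ · (‖a‖ + ‖b‖)`. [folklore] -/
theorem abs_weakIntegrand_sub_le (a b P : EuclideanSpace ℝ d) (D : d → EuclideanSpace ℝ d)
    {K₁ K₂ : ℝ} (hP : ‖P‖ ≤ K₁) (hD : ∀ i, ‖D i‖ ≤ K₂) :
    |(⟪a, P⟫_ℝ + ⟪a, ∑ i, a i • D i⟫_ℝ) - (⟪b, P⟫_ℝ + ⟪b, ∑ i, b i • D i⟫_ℝ)| ≤
      ‖a - b‖ * (K₁ + Fintype.card d * K₂ * (‖a‖ + ‖b‖)) := by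
  have hsum : ∀ w : EuclideanSpace ℝ d, ‖∑ i, w i • D i‖ ≤ Fintype.card d * K₂ * ‖w‖ := by
    intro w
    calc ‖∑ i, w i • D i‖ ≤ ∑ i, ‖w i • D i‖ := norm_sum_le _ _
      _ ≤ ∑ _i : d, ‖w‖ * K₂ := Finset.sum_le_sum fun i _ => by
          rw [norm_smul]
          exact mul_le_mul (PiLp.norm_apply_le w i) (hD i) (norm_nonneg _) (norm_nonneg _)
      _ = Fintype.card d * K₂ * ‖w‖ := by simp; ring
  have hlin : ∑ i, a i • D i - ∑ i, b i • D i = ∑ i, (a - b) i • D i := by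
    rw [← Finset.sum_sub_distrib]
    refine Finset.sum_congr rfl fun i _ => ?_
    rw [PiLp.sub_apply, sub_smul]
  have e1 : (⟪a, P⟫_ℝ + ⟪a, ∑ i, a i • D i⟫_ℝ) - (⟪b, P⟫_ℝ + ⟪b, ∑ i, b i • D i⟫_ℝ) =
      ⟪a - b, P⟫_ℝ + (⟪a - b, ∑ i, a i • D i⟫_ℝ + ⟪b, ∑ i, (a - b) i • D i⟫_ℝ) := by
    rw [← hlin, inner_sub_left, inner_sub_left, inner_sub_right]
    ring
  rw [e1]
  calc |⟪a - b, P⟫_ℝ + (⟪a - b, ∑ i, a i • D i⟫_ℝ + ⟪b, ∑ i, (a - b) i • D i⟫_ℝ)|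
      ≤ |⟪a - b, P⟫_ℝ| + (|⟪a - b, ∑ i, a i • D i⟫_ℝ| + |⟪b, ∑ i, (a - b) i • D i⟫_ℝ|) := by
        refine (abs_add_le _ _).trans ?_
        gcongr
        exact abs_add_le _ _
    _ ≤ ‖a - b‖ * K₁ + (‖a - b‖ * (Fintype.card d * K₂ * ‖a‖) +
          ‖b‖ * (Fintype.card d * K₂ * ‖a - b‖)) := by
        gcongr
        · exact (abs_real_inner_le_norm _ _).trans (mul_le_mul_of_nonneg_left hP (norm_nonneg _))
        · exact (abs_real_inner_le_norm _ _).trans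
            (mul_le_mul_of_nonneg_left (hsum a) (norm_nonneg _))
        · exact (abs_real_inner_le_norm _ _).trans
            (mul_le_mul_of_nonneg_left (hsum (a - b)) (norm_nonneg _))
    _ = ‖a - b‖ * (K₁ + Fintype.card d * K₂ * (‖a‖ + ‖b‖)) := by ring

omit [DecidableEq d] in
/-- Double integrals over `(0, T) × T^d` of two real fields with continuous space–time lifts on
`[0, T] × ℝ^d` differ by at most `T η` if the fields differ pointwise by at most `η` on
`(0, T) × T^d`. [folklore] -/
theorem norm_integral_sub_integral_le {T : ℝ} (hT : 0 ≤ T) {g₁ g₂ : ℝ → UnitAddTorus d → ℝ}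
    (h₁ : ContinuousOn (FunctionSpaces.Torus.stLift g₁) (Icc 0 T ×ˢ univ))
    (h₂ : ContinuousOn (FunctionSpaces.Torus.stLift g₂) (Icc 0 T ×ˢ univ)) {η : ℝ}
    (hη : ∀ t ∈ Ioo 0 T, ∀ x, ‖g₁ t x - g₂ t x‖ ≤ η) :
    ‖(∫ t in Ioo 0 T, ∫ x, g₁ t x) - ∫ t in Ioo 0 T, ∫ x, g₂ t x‖ ≤ T * η := by
  have hI : ∀ {g : ℝ → UnitAddTorus d → ℝ}, ContinuousOn (FunctionSpaces.Torus.stLift g) (Icc 0 T ×ˢ univ) →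
      IntegrableOn (fun t => ∫ x, g t x) (Ioo 0 T) volume := fun hg =>
    ((FunctionSpaces.Torus.continuousOn_integral_of_continuousOn_stLift hg).integrableOn_compact
      isCompact_Icc).mono_set Ioo_subset_Icc_self
  rw [← integral_sub (hI h₁) (hI h₂)]
  have hslice : ∀ t ∈ Ioo 0 T, ‖(∫ x, g₁ t x) - ∫ x, g₂ t x‖ ≤ η := by
    intro t ht
    have htI : t ∈ Icc 0 T := Ioo_subset_Icc_self ht
    rw [← integral_sub (FunctionSpaces.Torus.continuous_slice_of_continuousOn_stLift h₁ htI).integrable_unitAddTorus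
      (FunctionSpaces.Torus.continuous_slice_of_continuousOn_stLift h₂ htI).integrable_unitAddTorus]
    calc ‖∫ x, (g₁ t x - g₂ t x)‖ ≤ η * (volume : Measure (UnitAddTorus d)).real univ :=
          norm_integral_le_of_norm_le_const (ae_of_all _ fun x => hη t ht x)
      _ = η := by simp
  calc ‖∫ t in Ioo 0 T, ((∫ x, g₁ t x) - ∫ x, g₂ t x)‖
      ≤ η * (volume : Measure ℝ).real (Ioo 0 T) :=
        norm_setIntegral_le_of_norm_le_const (by rw [Real.volume_Ioo]; exact ENNReal.ofReal_lt_top)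
          hslice
    _ = T * η := by
        rw [Measure.real, Real.volume_Ioo, ENNReal.toReal_ofReal (by linarith)]
        ring

/-- **Uniform limits of Euler–Reynolds solutions with vanishing stress are weak Euler
solutions** (BDSV 2019, §2.2, proof of Thm. 1.1: "`v_q` converges uniformly to some continuous
`v` ... Since `R̊_q → 0` uniformly, the pair `(v, p)` solves the Euler equations"). Precisely: if
`(v_q, p_q, R_q)` are classical Euler–Reynolds solutions on `[0, T] × T^d`, `v_q → u` uniformly
on `[0, T] × T^d` and `‖R_q‖₀ → 0`, then `u` is a weak (distributional, pressure-free) Euler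
solution on `T^d × (0, T)` in the sense of `Torus.IsWeakEulerSolutionOn` (De Lellis–Székelyhidi
2009, §1). Proof: `u` is continuous on the compact `[0, T] × T^d` (uniform limit), hence
measurable and square integrable; `∫ ⟪u(t), ∇θ⟫ = lim ∫ ⟪v_q(t), ∇θ⟫ = 0`; and by
`Torus.IsEulerReynoldsOn.weak_identity` the weak-Euler functional of `v_q` against a test field
equals the Reynolds defect, which tends to `0` (`Torus.norm_integral_reynoldsDefect_le`), while
it converges to the functional of `u` by uniform convergence. [cite: BuckmasterEtAl2018, §2.2] -/
theorem isWeakEulerSolutionOn_of_unifLimit {T : ℝ} (hT : 0 < T)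
    {v : ℕ → ℝ → UnitAddTorus d → EuclideanSpace ℝ d} {p : ℕ → ℝ → UnitAddTorus d → ℝ}
    {R : ℕ → ℝ → UnitAddTorus d → d → EuclideanSpace ℝ d}
    {u : ℝ → UnitAddTorus d → EuclideanSpace ℝ d}
    (h : ∀ q, IsEulerReynoldsOn (Icc 0 T) (v q) (p q) (R q))
    (hv : ∀ ε > 0, ∃ N, ∀ q ≥ N, ∀ t ∈ Icc 0 T, ∀ x, ‖v q t x - u t x‖ ≤ ε)
    (hR : ∀ ε > 0, ∃ N, ∀ q ≥ N, ∀ t ∈ Icc 0 T, ∀ x, ‖R q t x‖ ≤ ε) :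
    FunctionSpaces.Torus.IsWeakEulerSolutionOn T u := by
  have hU : UniqueDiffOn ℝ (Icc 0 T) := uniqueDiffOn_Icc hT
  have hvc : ∀ q, ContinuousOn (FunctionSpaces.Torus.stLift (v q)) (Icc 0 T ×ˢ univ) := fun q =>
    (h q).smooth_velocity.continuousOn_stLift
  have huc : ContinuousOn (FunctionSpaces.Torus.stLift u) (Icc 0 T ×ˢ univ) := continuousOn_stLift_of_unifLimit hvc hv
  obtain ⟨C, hC⟩ := FunctionSpaces.Torus.exists_norm_le_of_continuousOn_of_isCompact huc isCompact_Icc subset_rfl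
  have hC0 : 0 ≤ C := (norm_nonneg _).trans (hC 0 ⟨le_rfl, hT.le⟩ 0)
  refine ⟨?_, ?_, ?_, ?_⟩
  -- (1) measurability on `(0,T) × ℝ^d`
  · exact (huc.mono (prod_mono Ioo_subset_Icc_self subset_rfl)).aestronglyMeasurable
      (measurableSet_Ioo.prod MeasurableSet.univ)
  -- (2) square integrability from the uniform bound
  · have hb : ∀ t ∈ Ioo 0 T, ∀ x, ‖u t x‖ₑ ^ 2 ≤ ENNReal.ofReal C ^ 2 := by
      intro t ht x
      gcongr
      rw [← ofReal_norm]
      exact ENNReal.ofReal_le_ofReal (hC t (Ioo_subset_Icc_self ht) x)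
    calc ∫⁻ t in Ioo 0 T, ∫⁻ x, ‖u t x‖ₑ ^ 2
        ≤ ∫⁻ _ in Ioo 0 T, ENNReal.ofReal C ^ 2 :=
          setLIntegral_mono' measurableSet_Ioo fun t ht =>
            calc ∫⁻ x, ‖u t x‖ₑ ^ 2 ≤ ∫⁻ _, ENNReal.ofReal C ^ 2 := lintegral_mono (hb t ht)
              _ = ENNReal.ofReal C ^ 2 := by rw [lintegral_const, measure_univ, mul_one]
      _ = ENNReal.ofReal C ^ 2 * volume (Ioo 0 T) := setLIntegral_const _ _
      _ < ⊤ := ENNReal.mul_lt_top (ENNReal.pow_lt_top ENNReal.ofReal_lt_top)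
          (by rw [Real.volume_Ioo]; exact ENNReal.ofReal_lt_top)
  -- (3) `u(t)` is weakly divergence free for every `t ∈ (0,T)`
  · refine (ae_restrict_iff' measurableSet_Ioo).2 (ae_of_all _ fun t ht => ?_)
    have htI : t ∈ Icc 0 T := Ioo_subset_Icc_self ht
    intro θ hθ
    have hgc : Continuous (FunctionSpaces.Torus.gradient θ) := hθ.gradient.continuous
    obtain ⟨Kθ, hKθ⟩ := isCompact_univ.exists_bound_of_continuousOn hgc.continuousOn
    have hKθ' : ∀ x, ‖FunctionSpaces.Torus.gradient θ x‖ ≤ Kθ := fun x => hKθ x (mem_univ x)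
    have hK0 : 0 ≤ Kθ := (norm_nonneg _).trans (hKθ' 0)
    have hut : Continuous (u t) := FunctionSpaces.Torus.continuous_slice_of_continuousOn_stLift huc htI
    have hiu : Integrable (fun x => ⟪u t x, FunctionSpaces.Torus.gradient θ x⟫_ℝ) volume :=
      (hut.inner hgc).integrable_unitAddTorus
    refine norm_le_zero_iff.1 (le_of_forall_pos_le_add fun ε hε => ?_)
    rw [zero_add]
    obtain ⟨N, hN⟩ := hv (ε / (Kθ + 1)) (div_pos hε (by linarith))
    have hvt : FunctionSpaces.Torus.IsSmooth (v N t) := (h N).smooth_velocity.isSmooth_slice htI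
    have hiv : Integrable (fun x => ⟪v N t x, FunctionSpaces.Torus.gradient θ x⟫_ℝ) volume :=
      (hvt.inner hθ.gradient).integrable
    have h0 : ∫ x, ⟪v N t x, FunctionSpaces.Torus.gradient θ x⟫_ℝ = 0 :=
      ((h N).divFree t htI).isWeaklyDivFree_holds hvt θ hθ
    have hsub : ∫ x, ⟪u t x, FunctionSpaces.Torus.gradient θ x⟫_ℝ = ∫ x, ⟪u t x - v N t x, FunctionSpaces.Torus.gradient θ x⟫_ℝ := by
      simp_rw [inner_sub_left]
      rw [integral_sub hiu hiv, h0, sub_zero]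
    rw [hsub]
    calc ‖∫ x, ⟪u t x - v N t x, FunctionSpaces.Torus.gradient θ x⟫_ℝ‖
        ≤ (ε / (Kθ + 1) * Kθ) * (volume : Measure (UnitAddTorus d)).real univ := by
          refine norm_integral_le_of_norm_le_const (ae_of_all _ fun x => ?_)
          calc ‖⟪u t x - v N t x, FunctionSpaces.Torus.gradient θ x⟫_ℝ‖
              ≤ ‖u t x - v N t x‖ * ‖FunctionSpaces.Torus.gradient θ x‖ := norm_inner_le_norm _ _
            _ ≤ ε / (Kθ + 1) * Kθ := by
                refine mul_le_mul ?_ (hKθ' x) (norm_nonneg _) (div_pos hε (by linarith)).le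
                rw [norm_sub_rev]
                exact hN N le_rfl t htI x
      _ = ε / (Kθ + 1) * Kθ := by simp
      _ ≤ ε := by
          rw [div_mul_eq_mul_div, div_le_iff₀ (by linarith)]
          nlinarith
  -- (4) the weak identity
  · intro ψ hψ hψdiv
    have hψI : FunctionSpaces.Torus.IsSmoothSpaceTimeOn (Icc 0 T) ψ := hψ.1.1.contDiffOn
    have hψ'I : FunctionSpaces.Torus.IsSmoothSpaceTimeOn (Icc 0 T) (FunctionSpaces.Torus.timeDeriv ψ) := hψ.1.timeDeriv.1.contDiffOn
    have hDψ : ∀ j, FunctionSpaces.Torus.IsSmoothSpaceTimeOn (Icc 0 T) (fun t => FunctionSpaces.Torus.partialDeriv j (ψ t)) := fun j =>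
      hψI.partialDeriv hU j
    obtain ⟨K₁, hK₁⟩ := hψ'I.exists_norm_le_of_isCompact isCompact_Icc subset_rfl
    have hK₁0 : 0 ≤ K₁ := (norm_nonneg _).trans (hK₁ 0 ⟨le_rfl, hT.le⟩ 0)
    obtain ⟨K₂, hK₂0, hK₂⟩ : ∃ K₂, 0 ≤ K₂ ∧
        ∀ j, ∀ t ∈ Icc 0 T, ∀ x, ‖FunctionSpaces.Torus.partialDeriv j (ψ t) x‖ ≤ K₂ := by
      choose K hK using fun j => (hDψ j).exists_norm_le_of_isCompact isCompact_Icc subset_rfl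
      refine ⟨∑ j, |K j|, Finset.sum_nonneg fun j _ => abs_nonneg _, fun j t ht x => ?_⟩
      exact ((hK j t ht x).trans (le_abs_self _)).trans
        (Finset.single_le_sum (fun i _ => abs_nonneg (K i)) (Finset.mem_univ j))
    -- the weak-Euler integrand in coordinates: `⟪w, (w·∇)ψ⟫ = ⟪w, ∑ᵢ wᵢ ∂ᵢψ⟫`
    have hconv : ∀ (w : UnitAddTorus d → EuclideanSpace ℝ d) (t : ℝ) (x : UnitAddTorus d),
        FunctionSpaces.Torus.convect w (ψ t) x = ∑ i, w x i • FunctionSpaces.Torus.partialDeriv i (ψ t) x := fun w t x =>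
      FunctionSpaces.Torus.fderiv_apply_eq_sum_partialDeriv ((hψ.1.isSmooth_slice t).isContDiff (by simp)) x (w x)
    -- continuity of the space–time lift of the limit integrand
    have hGu : ContinuousOn (FunctionSpaces.Torus.stLift fun t x =>
        ⟪u t x, FunctionSpaces.Torus.timeDeriv ψ t x⟫_ℝ + ⟪u t x, FunctionSpaces.Torus.convect (u t) (ψ t) x⟫_ℝ) (Icc 0 T ×ˢ univ) := by
      have e : (FunctionSpaces.Torus.stLift fun t x => ⟪u t x, FunctionSpaces.Torus.timeDeriv ψ t x⟫_ℝ + ⟪u t x, FunctionSpaces.Torus.convect (u t) (ψ t) x⟫_ℝ) =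
          fun z => ⟪FunctionSpaces.Torus.stLift u z, FunctionSpaces.Torus.stLift (FunctionSpaces.Torus.timeDeriv ψ) z⟫_ℝ +
            ⟪FunctionSpaces.Torus.stLift u z, ∑ i, (FunctionSpaces.Torus.stLift u z) i • FunctionSpaces.Torus.stLift (fun t => FunctionSpaces.Torus.partialDeriv i (ψ t)) z⟫_ℝ := by
        funext z
        obtain ⟨t, y⟩ := z
        simp only [FunctionSpaces.Torus.stLift_apply, hconv]
      rw [e]
      refine (huc.inner hψ'I.continuousOn_stLift).add (huc.inner ?_)
      refine continuousOn_finsetSum _ fun i _ => ?_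
      exact ((EuclideanSpace.proj i).continuous.comp_continuousOn huc).smul
        (hDψ i).continuousOn_stLift
    -- smoothness of the approximating integrands
    have hGv : ∀ q, FunctionSpaces.Torus.IsSmoothSpaceTimeOn (Icc 0 T) (fun t x =>
        ⟪v q t x, FunctionSpaces.Torus.timeDeriv ψ t x⟫_ℝ + ⟪v q t x, FunctionSpaces.Torus.convect (v q t) (ψ t) x⟫_ℝ) := fun q =>
      ((h q).smooth_velocity.inner hψ'I).add
        ((h q).smooth_velocity.inner ((h q).smooth_velocity.convect hψI hU))
    -- main estimate: the functional of `u` is bounded by every `ε > 0`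
    refine norm_eq_zero.1 (le_antisymm (le_of_forall_pos_le_add fun ε hε => ?_) (norm_nonneg _))
    rw [zero_add]
    set L : ℝ := K₁ + Fintype.card d * K₂ * (C + (C + 1)) with hL_def
    have hL0 : 0 ≤ L := by positivity
    obtain ⟨N₁, hN₁⟩ := hv (min 1 (ε / (2 * (T * L + 1))))
      (lt_min one_pos (div_pos hε (by positivity)))
    obtain ⟨N₂, hN₂⟩ := hR (ε / (2 * (T * (Fintype.card d * K₂) + 1))) (div_pos hε (by positivity))
    have hq₁ := hN₁ (max N₁ N₂) (le_max_left _ _)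
    have hq₂ := hN₂ (max N₁ N₂) (le_max_right _ _)
    set q : ℕ := max N₁ N₂ with hq_def
    -- (a) the Reynolds defect of `v_q` is small
    have hdefect : ‖∫ t in Ioo 0 T, ∫ x,
        (⟪v q t x, FunctionSpaces.Torus.timeDeriv ψ t x⟫_ℝ + ⟪v q t x, FunctionSpaces.Torus.convect (v q t) (ψ t) x⟫_ℝ)‖ ≤ ε / 2 := by
      rw [(h q).weak_identity subset_rfl hψ hψdiv]
      calc ‖∫ t in Ioo 0 T, ∫ x, ∑ j, ⟪R q t x j, FunctionSpaces.Torus.partialDeriv j (ψ t) x⟫_ℝ‖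
          ≤ T * (Fintype.card d * (ε / (2 * (T * (Fintype.card d * K₂) + 1)) * K₂)) :=
            norm_integral_reynoldsDefect_le hT.le (div_pos hε (by positivity)).le
              (fun t ht x => hq₂ t (Ioo_subset_Icc_self ht) x)
              (fun t ht x j => hK₂ j t (Ioo_subset_Icc_self ht) x)
        _ = (T * (Fintype.card d * K₂)) * (ε / (2 * (T * (Fintype.card d * K₂) + 1))) := by ring
        _ ≤ ε / 2 := by
            rw [mul_div_assoc', div_le_div_iff₀ (by positivity) (by positivity)]
            nlinarith [mul_nonneg hT.le (mul_nonneg (Nat.cast_nonneg (Fintype.card d)) hK₂0)]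
    -- (b) the functionals of `u` and `v_q` are close
    have hclose : ‖(∫ t in Ioo 0 T, ∫ x,
          (⟪u t x, FunctionSpaces.Torus.timeDeriv ψ t x⟫_ℝ + ⟪u t x, FunctionSpaces.Torus.convect (u t) (ψ t) x⟫_ℝ)) -
        ∫ t in Ioo 0 T, ∫ x,
          (⟪v q t x, FunctionSpaces.Torus.timeDeriv ψ t x⟫_ℝ + ⟪v q t x, FunctionSpaces.Torus.convect (v q t) (ψ t) x⟫_ℝ)‖ ≤ ε / 2 := by
      have hη : ∀ t ∈ Ioo 0 T, ∀ x,
          ‖(⟪u t x, FunctionSpaces.Torus.timeDeriv ψ t x⟫_ℝ + ⟪u t x, FunctionSpaces.Torus.convect (u t) (ψ t) x⟫_ℝ) -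
            (⟪v q t x, FunctionSpaces.Torus.timeDeriv ψ t x⟫_ℝ + ⟪v q t x, FunctionSpaces.Torus.convect (v q t) (ψ t) x⟫_ℝ)‖ ≤
            min 1 (ε / (2 * (T * L + 1))) * L := by
        intro t ht x
        have htI : t ∈ Icc 0 T := Ioo_subset_Icc_self ht
        have hd : ‖u t x - v q t x‖ ≤ min 1 (ε / (2 * (T * L + 1))) := by
          rw [norm_sub_rev]; exact hq₁ t htI x
        have hvb : ‖v q t x‖ ≤ C + 1 := by
          calc ‖v q t x‖ = ‖(v q t x - u t x) + u t x‖ := by rw [sub_add_cancel]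
            _ ≤ ‖v q t x - u t x‖ + ‖u t x‖ := norm_add_le _ _
            _ ≤ 1 + C := add_le_add ((hq₁ t htI x).trans (min_le_left _ _)) (hC t htI x)
            _ = C + 1 := add_comm _ _
        rw [Real.norm_eq_abs, hconv (u t) t x, hconv (v q t) t x]
        calc |(⟪u t x, FunctionSpaces.Torus.timeDeriv ψ t x⟫_ℝ + ⟪u t x, ∑ i, u t x i • FunctionSpaces.Torus.partialDeriv i (ψ t) x⟫_ℝ) -
              (⟪v q t x, FunctionSpaces.Torus.timeDeriv ψ t x⟫_ℝ +
                ⟪v q t x, ∑ i, v q t x i • FunctionSpaces.Torus.partialDeriv i (ψ t) x⟫_ℝ)|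
            ≤ ‖u t x - v q t x‖ * (K₁ + Fintype.card d * K₂ * (‖u t x‖ + ‖v q t x‖)) :=
              abs_weakIntegrand_sub_le _ _ _ _ (hK₁ t htI x) fun i => hK₂ i t htI x
          _ ≤ min 1 (ε / (2 * (T * L + 1))) * L := by
              refine mul_le_mul hd ?_ (by positivity) (le_min zero_le_one (by positivity))
              rw [hL_def]
              gcongr
              exact hC t htI x
      calc _ ≤ T * (min 1 (ε / (2 * (T * L + 1))) * L) :=
            norm_integral_sub_integral_le hT.le hGu (hGv q).continuousOn_stLift hη
        _ ≤ T * (ε / (2 * (T * L + 1)) * L) := by gcongr; exact min_le_right _ _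
        _ = (T * L) * (ε / (2 * (T * L + 1))) := by ring
        _ ≤ ε / 2 := by
            rw [mul_div_assoc', div_le_div_iff₀ (by positivity) (by positivity)]
            nlinarith [mul_nonneg hT.le hL0]
    -- (c) conclude
    calc ‖∫ t in Ioo 0 T, ∫ x, (⟪u t x, FunctionSpaces.Torus.timeDeriv ψ t x⟫_ℝ + ⟪u t x, FunctionSpaces.Torus.convect (u t) (ψ t) x⟫_ℝ +
          0 * ⟪u t x, FunctionSpaces.Torus.laplacian (ψ t) x⟫_ℝ)‖
        = ‖∫ t in Ioo 0 T, ∫ x, (⟪u t x, FunctionSpaces.Torus.timeDeriv ψ t x⟫_ℝ + ⟪u t x, FunctionSpaces.Torus.convect (u t) (ψ t) x⟫_ℝ)‖ := by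
          simp only [zero_mul, add_zero]
      _ ≤ ‖(∫ t in Ioo 0 T, ∫ x, (⟪u t x, FunctionSpaces.Torus.timeDeriv ψ t x⟫_ℝ + ⟪u t x, FunctionSpaces.Torus.convect (u t) (ψ t) x⟫_ℝ)) -
            ∫ t in Ioo 0 T, ∫ x,
              (⟪v q t x, FunctionSpaces.Torus.timeDeriv ψ t x⟫_ℝ + ⟪v q t x, FunctionSpaces.Torus.convect (v q t) (ψ t) x⟫_ℝ)‖ +
          ‖∫ t in Ioo 0 T, ∫ x,
              (⟪v q t x, FunctionSpaces.Torus.timeDeriv ψ t x⟫_ℝ + ⟪v q t x, FunctionSpaces.Torus.convect (v q t) (ψ t) x⟫_ℝ)‖ :=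
          norm_le_norm_sub_add _ _
      _ ≤ ε / 2 + ε / 2 := add_le_add hclose hdefect
      _ = ε := add_halves ε

end Limit

end Torus

end Literature.Analysis.FluidPDE
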